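import Mathlib
import HarnessLib
import Summits.HodgeConjecture.HodgeConjecture.Theorems.NikulinTwinTransportTwinTwistorTransportReduction
import Summits.HodgeConjecture.HodgeConjecture.Theorems.NikulinTwinTransportTwinTwistorTransportMukaiLiftDefs
import Summits.HodgeConjecture.HodgeConjecture.Theorems.NikulinTwinTransportTwinTwistorTransportLiftIffTwin
import Summits.HodgeConjecture.HodgeConjecture.Theorems.NikulinTwinTransportTwinTwistorTransportMukaiLiftCmTwinAnchor
import Summits.HodgeConjecture.HodgeConjecture.Theorems.NikulinTwinTransportTwinTwistorTransportTwistorReach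
import Summits.HodgeConjecture.HodgeConjecture.Theorems.NikulinTwinTransportTwinTwistorTransportMukaiLiftHilbertPackageOfFacts
import Literature.AlgebraicGeometry.Hyperkaehler.OGradySixType
import Literature.AlgebraicGeometry.HodgeTheory.ChernCharacterBetti
import Literature.AlgebraicGeometry.ModuliOfSheaves.MuStability
import Literature.AlgebraicGeometry.HodgeTheory.KaehlerClass
import Literature.AlgebraicGeometry.Motives.ChernClasses
import Literature.AlgebraicGeometry.Surfaces.PolarisedK3TwinKuranishiFamily
import Literature.AlgebraicGeometry.Surfaces.K3HodgeTypesHolds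
import Literature.AlgebraicGeometry.Surfaces.K3ComplexMultiplication
import Literature.AlgebraicGeometry.Surfaces.K3SurfaceBuskinLeaves
import Literature.AlgebraicGeometry.Surfaces.K3SurfaceBuskinLeavesProofs
import Literature.AlgebraicGeometry.Surfaces.K3LatticeInvariants
import Literature.AlgebraicGeometry.Surfaces.K3LatticeInvariantsHolds
import Literature.AlgebraicGeometry.Surfaces.K3LatticeInvariantsSignatureProofs
import Literature.AlgebraicGeometry.HodgeTheory.HypersurfaceHolomorphicFormsProofs
import Literature.AlgebraicGeometry.HodgeTheory.HodgeFiltrationModelsReductionProofs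
import Literature.NumberTheory.Transcendental.DeRhamTheoremMultiplicative
import Summits.HodgeConjecture.HodgeConjecture.Theorems.TwinTwistorTransport.Negative.NoOddSelfAnchor
import Summits.HodgeConjecture.HodgeConjecture.Theorems.TwinTwistorTransport.Negative.TypedClauseHygiene
import Summits.HodgeConjecture.HodgeConjecture.Theorems.TwinTwistorTransport.Negative.WithoutRationalityOrHalving
import Summits.HodgeConjecture.HodgeConjecture.Theorems.TwinTwistorTransport.Negative.GenericFirstLine
import Summits.HodgeConjecture.HodgeConjecture.Theorems.TwinTwistorTransport.Negative.NikulinParity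
import Summits.HodgeConjecture.HodgeConjecture.Theorems.TwinTwistorTransport.Negative.PolystableCrossTerm
import Summits.HodgeConjecture.HodgeConjecture.Theorems.TwinTwistorTransport.Negative.AnchorConeCondition

/-!
# Line `mukai-lift-full-similitude` — crux `NikulinTwinTransport.TwinTwistorTransport`
# (stmt-HodgeConjecture-14393, route HodgeConjecture/NikulinTwinTransport, rank 4)

Skeleton of the line (crux-plan, planner-cruxplan-stmt-HodgeConjecture-14393-mukai-lift-full-simi-0,
2026-08-16; OWNED AND RESHAPED by the lead prover-line-stmt-HodgeConjecture-14393-1, gen 1, same day: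
`Marked` replaced by the Literature predicate `IsMarkedK3` (PolarisedK3TwinKuranishiFamily, symbol for
symbol the same clauses — no restatement), stub `K3PeriodFacts` reshaped to `K3MarkingExists` with
`K3PeriodSurjective` assumed by name and `Huybrechts_K3_hodgeTypes_H2_holds` used, see Stub 6), from the crux idea `Cruxes/TwinTwistorTransport/Ideas/mukai-lift-full-similitude.md`
(triage r1: 2/2 pass; sharpenings TRIAGE-r1-1 §mukai (K1 class-level GRR passes formally; strike
why-easier (b)) and TRIAGE-r1-2 §mukai (realise `2ψ̃`, run GRR first, Markman 5.14–5.15 at Pic-`0`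
nodes TWISTED, extraction map `r = Zᵗ ∘ L`, record `c ≠ 0` via Fujiki)).

## The crux (typed, rev 7) and the tree's reduction

`TwinTwistorTransport` (OUTPUT level): every projective K3 `S` with integral generator `p` of `H⁴`
has a projective K3 partner `S″`, `p″` and an ALGEBRAIC `Ψ : H²(S″) ≃ H²(S)` whose inverse is
rational, type-preserving and halves the cup form.  The LANDED reduction
`Theorems.NikulinTwinTransport.twinTwistorTransport_of_twinTransport` (file
`NikulinTwinTransportTwinTwistorTransportReduction`) derives it from the three K3 facts
(`Huybrechts_K3_periodSurjective_projective`, `Huybrechts_K3_marking_exists`,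
`Huybrechts_K3_hodgeTypes_H2` — named unproved Literature facts, admissible hypotheses) and
`TwinTransportFor[M]`: for ONE rational `2`-similitude `M` of `Λ_ℂ` with rational inverse, the twin
similitude `η⁻¹ ∘ M ∘ η′` is algebraic on EVERY `M`-twin pair of marked projective K3 surfaces.
This skeleton proves `TwinTransportFor[M]` for the `M` of its anchor from six stubs and feeds it to
that theorem, so `TwinTwistorTransport_of` concludes the route declaration BY NAME.

## The line: lift the twin to the Mukai lattice and transport ONE full-`H²` similitude of
## hyperkähler manifolds of different `K3^{[n]}`-types

LEVER (card).  `Ψ̃(r, x, s) := (r, Ψx, 2s)` is a `2`-similitude of the Mukai lattice; for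
`w = (1,0,−1) ↦ v = (1,0,−2)` it restricts to `ψ̃ : H²(S″^{[2]}) = w^⊥ → v^⊥ = H²(S^{[3]})`,
`x ↦ Ψx` on `H²(S″)`, `δ₂ ↦ δ₃` (`q: −2 ↦ −4`): a rational Hodge `2`-similitude of the WHOLE second
cohomology `(Λ ⊕ ⟨−2⟩)(2) ≅_ℚ Λ ⊕ ⟨−4⟩` between irreducible holomorphic symplectic manifolds of
`K3^{[2]}`- and `K3^{[3]}`-type (the type jump is forced by parity, `Negative/NoOddSelfAnchor`:
`b₂ = 23` odd admits no self-`2`-similitude).  In the marking `L := Λ_ℂ ⊕ ℂδ` of both sides the lift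
of `M` is `liftEnd M := M ⊕ id`, and `liftForm_liftEnd` below PROVES (kernel-checked) that it is a
`2`-similitude `(L, q₂) → (L, q₃)` fixing `δ`, rational with rational inverse when `M` is.  The crux
is EQUIVALENT to algebraicity of the lift on `S^{[3]} × S″^{[2]}` (stub `LiftIffTwin`, through the
universal-family links of `HilbertPackage`), and the lift is transported in MARKMAN's own
setting (pairs of `K3^{[n]}`-type manifolds, one new groupoid generator of `2`-cyclic similitude type):
anchor = Hilbert schemes of a Nikulin pair (`NikulinAnchor` + `LiftIffTwin`), carrier = the
convolution kernel `𝒦_P = ℰ_v^∨ ∘ P ∘ ℰ_w` of universal ideal sheaves (twisted, slope-stable on an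
open cone of `ψ̃`-matched classes), engine = Markman 2024 Thm 1.5 along generic diagonal twistor
paths of the 21-dimensional matched family `𝒯̃ ≅ D_{Λ⊕⟨−2⟩}` (`LiftEngine`, fed by the
period-domain connectivity `TwistorReach`).

## Stubs (statement `def`s below; sorried registered forms in `namespace Stub`; sizes / sources in
## `Lines/mukai-lift-full-similitude.md`)

* `HilbertPackage` (XL formal, known: Beauville 1983 §6–9, Fogarty, Fujiki 1987, Ellingsrud–
  Göttsche–Lehn 2001, Huybrechts 1999): for every `n ≥ 2` a common deformation class `Xr` and, over
  every marked projective K3 `(S, η, p, x)`, a numerically-`K3^{[n]}` marked projective irreducible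
  symplectic `2n`-fold `(X, θ, pX)` with period `(x, 0)` (`MarkedHK`) deformation equivalent to `Xr`,
  with Hilbert-type LINKS (`IsHilbLink`): algebraic `ι` on `X × S`, `ρ` on `S × X` with
  `θ ∘ [ι]_* = (η, 0)`, `η ∘ [ρ]_* = c·pr₁ ∘ θ` (`c ≠ 0`), `δ = θ⁻¹(0,1)` algebraic, and an algebraic
  `ζ` with `b ∪ ζ = (θ b)₂ · pX`.  Instance: `X = S^{[n]}`, `ι = [Ξ_n]`, `ρ ∝ [Ξ_n]ᵗ ∪ δ^{2n−2}`,
  `ζ ∝ δ^{2n−1}` (polarised Fujiki relation).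
* `NikulinAnchor` (L–XL, known in print: Varesco 2023 Thm 2.1, van Geemen–Sarti 2007 §2): a rational
  `2`-similitude pair `(M, N)` and ONE marked projective `M`-twin pair on which `η⁻¹Mη′` is algebraic.
* `LiftIffTwin` (L formal; the card's `Transfer` crux ⟺ C⁺, pointwise along Hilbert-type links): twin
  algebraic at `(S, S′)` ⟺ lift algebraic at `(X, X′)` — "⇒": `ψ̃ = c′⁻¹·[ι]∘[γ]∘[ρ′] + [δ ⊠ ζ′]`;
  "⇐" (extraction): `η⁻¹Mη′ = c⁻¹·[ρ]∘[γ̃]∘[ι′]` (compositions of correspondences in dimensions `2,4,6`).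
* `TwistorReach` (M, PROVABLE NOW: Huybrechts K3 book Ch. 7 Prop. 3.2 for the signature-`(3,20)`
  lattice `Λ ⊕ ⟨−2⟩`; adapt `K3TwistorLines.Huybrechts_K3_periodDomain_twistorConnected_holds`):
  any two points of the period domain of `(L, q₂)` are joined by a chain of GENERIC twistor lines.
* `LiftEngine` (THE HEART, research; Markman 2024 Thm 1.1/1.5 with "isometry, `(n,n)`" replaced by
  "`2`-similitude, `(3,2)`"): if the lift is algebraic at ONE `M̃`-matched marked pair in the
  deformation classes `(Xr, Xr′)`, it is algebraic at EVERY `M̃`-matched marked pair in those classes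
  whose `X′`-period is chain-connected to the anchor's.
* `K3MarkingExists` (lead's reshape of the planner's `K3PeriodFacts`: of the three NAMED facts consumed
  by the tree's reduction, the Hodge types of `H²(K3)` are now PROVED in the tree
  (`Huybrechts_K3_hodgeTypes_H2_holds`), period surjectivity is the route crux `K3PeriodSurjective`
  (stmt-HodgeConjecture-15154) assumed BY NAME by `TwinTwistorTransport_of`, and the existence of
  markings `Huybrechts_K3_marking_exists` remains as this stub; every line of this crux is conditional
  on it and on 15154: `S″` can only be exhibited through period surjectivity, Disproof §obligations).

`TwinTwistorTransport_of` (no `sorry`): `NikulinAnchor` gives `(M, N)` and the anchor K3 pair;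
`HilbertPackage` its Hilbert cube/square `(X₀, X₀′)`; `LiftIffTwin` (⇒) the lift algebraic there (for
every orientation family); for the `M`-twin pair `(S, S′)` handed over by
`twinTwistorTransport_of_twinTransport` (fed with `K3PeriodSurjective`, `K3MarkingExists` and the theorem
`Huybrechts_K3_hodgeTypes_H2_holds`), `HilbertPackage` gives `(X, X′)` in the
same deformation classes, `TwistorReach` a generic chain from the anchor's `X₀′`-period `(x₀′, 0)` to
`(x′, 0)`, `LiftEngine` the lift algebraic at `(X, X′)`, and `LiftIffTwin` (⇐) the twin algebraic at
`(S, S′)`.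

## Disproof / negatives honoured (`Cruxes/TwinTwistorTransport/Disproof.lean` @2026-08-16T05:09Z,
## NO KILL; the seven LANDED `Theorems/TwinTwistorTransport/Negative/*` modules are imported above)

* T1/T1′ (`selfAnchor_smul_passes_all_but_rationality`, `withoutR_of_diagonalClass`: (R) is the whole
  content): (R) for `Ψ⁻¹` is produced inside `anchorAt_of_twinTransport` from the RATIONALITY of `N`
  (`IsTwoSimilitudePair`, used at `NikulinAnchor`/`LiftEngine`) — never from `ℂ`-scaling; the lift
  `liftEnd M` is rational iff `M` is (`liftEnd_ofZL`).
* T2/T7 (`halving_id_forces_zero`, `halving_iff_twoSimilitude`): the multiplier is built in —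
  `liftForm_liftEnd : q₃(M̃u, M̃v) = 2·q₂(u, v)`; `Ψ = id` is no instance at either level.
* T3 (`Negative.no_self_twoSimilitude_of_odd`, `no_isometric_twin_of_odd`): `S″` is the `M`-twin from
  period surjectivity, never `S`; one level up `b₂ = 23` is odd on both sides, which is WHY the lift
  goes `K3^{[2]} → K3^{[3]}` (`(Λ⊕⟨−2⟩)(2) ≇_ℚ Λ⊕⟨−2⟩`).
* T4 (`not_integral_halving`): `M` is only rational (`IsRatEnd`), `N` likewise; nothing integral is asked.
* T8/T9: `∀ μ` threaded through every stub; signs of generators absorbed by `twinTwistorTransport_of_twinTransport`.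
* `Negative/GenericFirstLine` (`eq_zero_of_oneOne_along_generic_line`, `exists_integral_perp_of_rational_ray`):
  no first line is prescribed — `TwistorReach`/`LiftEngine` quantify chains of GENERIC lines
  existentially (`OnCommonGenericLiftLine`: `W^⊥ ∩ (Λ ⊕ ℤδ) = 0`), and the carrier inside `LiftEngine`
  is TWISTED (Azumaya `End 𝒦_P`), so no `c₁` is carried untwisted along a generic line.
* `Negative/NikulinParity`, `Negative/AnchorConeCondition`, `Negative/PolystableCrossTerm`
  (`evenEight_ne_nodal_add_two_smul`, `no_minusTwo_class_of_even_degree`, `finrank_le_of_restrict_eq_smul`):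
  they constrain the CARRIER of the informal proof of `LiftEngine` (twisted, slope-STABLE `End 𝒦_P` on an
  open cone of matched classes on `X^{[3]} × Y′^{[2]}`; no Serre sheaf, no nodal modification, no
  polystable splitting) — recorded in the line card; no stub asserts any of their refuted strengthenings.
* Negatives index (`ledger negatives`: DerivedTorelliFermat exhaustion, ELineConnectivity): the second
  is the prescribed-first-line obstruction, honoured as above.
-/

/-!
## Reshape r2 (lead c3, prover-line-stmt-HodgeConjecture-14393-c3-0, 2026-08-16)

* `NikulinAnchor` (an UNCONDITIONAL `∃ S₀ S₀'` of K3 surfaces — misstated for the tree: no K3 surface is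
  constructible, surfaces are exhibited only through period surjectivity) ↦ **`CmTwinAnchor`**, the
  CONDITIONAL CM form: granted `K3PeriodSurjective` (route crux stmt-HodgeConjecture-15154, by name),
  Buskin's theorem `HodgeIsometryAlgebraic` (route item stmt-HodgeConjecture-13675, by name) and the
  three open named facts `OpenFacts`, for EVERY rational lattice `2`-similitude pair `(M, N)` and every
  orientation family there is a marked projective `M`-twin pair on which `η₀⁻¹ ∘ M ∘ η₀'` is algebraic —
  the sibling line's LANDED `OrdinaryPrimeAnchors.stub_cmTwinAnchor` (p109741) at the seed
  `CmNormAnchors.exists_cmNormPeriod 2` (vocabularies agree definitionally: `IsMarkedK3 ≡ MarkedK3[]`,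
  `PeriodPt ≡ PeriodPt[]`, `IsTwoSimilitudePair ≡ Latt[]`, `TwinAlg ≡ Good[]`).  `(M, N)` is no longer
  produced by the anchor: `TwinTwistorTransport_of` takes it from the landed
  `exists_twoSimilitude_k3Lattice`.
* `LiftEngine` ↦ per-orientation-family form (the anchor hypothesis and the conclusion for the SAME `μ`;
  `LiftAlg … μ …` depends on `μ` through `complexGysin μ`, and Disproof T8 is only a shadow, so this is
  the form a transport argument actually proves).
* `K3MarkingExists` ↦ **`OpenFacts`** `:= Huybrechts_K3_marking_exists ∧
  cupProduct_mem_algebraicClasses_tripleProduct_surfaces ∧ Buskin2019_hodgeConjectureFor_square_of_CM`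
  (the named Literature inputs still unproved; de Rham's theorem is the tree's
  `exists_deRhamIsoFamily_holds`, the Hodge types of `H²(K3)` are `Huybrechts_K3_hodgeTypes_H2_holds`).
* `TwinTwistorTransport_of` takes `HodgeIsometryAlgebraic` by name in addition to `K3PeriodSurjective`
  and `CupProductAlgebraic`; the anchor is obtained INSIDE the `∀ μ` of `TwinTransportFor[M]`.
Registered stubs after r2: `HilbertPackage`, `CmTwinAnchor`, `TwistorReach`, `LiftEngine`, `OpenFacts`
(`LiftIffTwin` is the landed theorem, p100236).

## Reshape r3 (lead c3, same day): the heart made TIGHT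

`LiftEngine` (r2: algebraicity of the lift at EVERY `M̃`-matched marked pair of the deformation classes —
strictly stronger than the composition needs, HC-strength on hyperkähler `10`-folds unrelated to any K3) is
now quantified over marked projective `M`-twin K3 pairs `(S, S′)` together with Hilbert-type LINKED marked
`6`- and `4`-folds `(X, X′)` over them (the only pairs `TwinTwistorTransport_of` feeds it).  In this form the heart
is implied by twin transport for `M` through `LiftIffTwin` (⇒) — `Theorems…MukaiLift.liftEngine_of_twinTransport`,
`liftEngine_of_twinTwistorTransport` (tightness file, --supports) — so heart ⟺ crux modulo the formal stubs, Buskin,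
`CompCorr`, `CupProductAlgebraic` and the K3 facts: the line carries exactly the crux's research content.

## Reshape r4 (lead c3, after wave 1): two stubs LANDED, the fact stub sharpened

* `CmTwinAnchor` LANDED (p112591, `Theorems…MukaiLiftCmTwinAnchor`), `TwistorReach` LANDED (p112644,
  `Theorems…TwistorReach`, part C over gen-1's p101289/p102031/p102934): `Stub.CmTwinAnchor`, `Stub.TwistorReach`
  are now the theorems; tightness of the heart LANDED (p112628, `Theorems…MukaiLiftEngineTightness`).
* `OpenFacts` ↦ `K3_finrank_complexBetti_two ∧ K3_exists_orientation_signature_hodgeRiemann_ample ∧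
  Buskin2019_hodgeConjectureFor_square_of_CM` — exactly the undischarged leaves (wave-1 audit); markings are
  assembled inside `TwinTwistorTransport_of` by `Huybrechts_K3_marking_exists_holds_of` from the two leaves and five
  landed `_holds`; `cupProduct_mem_algebraicClasses_tripleProduct_surfaces` is DERIVED from `CupProductAlgebraic`.
* `HilbertPackage`: wave-1 audit = definition gap (missing Literature facts M1–M4 on `S^{[n]}`: Beauville 1983 Prop. 6 /
  Thm 3 decomposition with `i = [Ξ_n]_*`, Fujiki relation, polarised Fujiki links, deformation equivalence of all
  `S^{[n]}`); conditional glue `HilbertPackage_of_hilbertSchemeFacts` kernel-checked by the worker (wave 2 files it).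
Open sorries after r4: `HilbertPackage`, `LiftEngine` (heart), `OpenFacts`.

## Reshape r6 (lead c3): the heart SPLIT into its falsifiable half and its transport half

`LiftEngine` (black box: anchor algebraic ⟹ far pair algebraic) ↦ `LiftCarrier` (at every linked anchor over an
algebraic twin pair, the lift is realised — up to the `c₂(X₀′)`-twist `∪ pr₂^*λ` — by the `κ`-class of a
`μ_Ω`-STABLE VECTOR BUNDLE on the `10`-fold `X₀ ⊗ X₀′`, typed over the tree's `IsMuStable` / `HasChRank` /
`IsKaehlerClass` / `PositivelyOriented` / `IsVectorBundle` / `ChernCharacterBetti`; NOT crux-implied: the mechanism's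
commitment, the disprover's target) ∧ `LiftTransport` (carrier at the anchor + generic chain ⟹ lift algebraic at the
linked far pair; TIGHT: `Theorems…MukaiLift.liftTransport_of_twinTransport`).  `TwinTwistorTransport_of` feeds the
CM anchor + Hilbert links to `LiftCarrier` and everything to `LiftTransport`.  Open sorries after r6: `HilbertPackage`
(→ `HilbertFacts` once the farm has built the wave-2 Literature module), `OpenFacts`, `LiftCarrier`, `LiftTransport`.

## Reshape r7 (lead c4, prover-line-stmt-HodgeConjecture-14393-c4-0, 2026-08-16): `HilbertPackage` DISCHARGED
## modulo named facts

* `HilbertPackage` is no longer a stub: the LANDED glue `Theorems…MukaiLift.HilbertPackage_of_facts` (p116353, c3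
  wave 2) derives it verbatim from the four named Hilbert-scheme facts of
  `Literature/AlgebraicGeometry/Hyperkaehler/K3HilbertSchemeBeauville{,Fujiki}` (p96887, p114796), which become the
  named-fact stub **`HilbertFacts`** `:= Grothendieck_hilbertSchemeOfPoints_exists ∧ Beauville1983_hilbertScheme_K3 ∧
  Beauville1983_hilbertScheme_K3_markedLinks ∧ Beauville1983_hilbertScheme_K3_deformationEquivalent` (Göttsche Thm 1.1.2;
  Beauville 1983 §6 Thm 3 / Prop 6 / §9; Huybrechts 1999 §2).  Like `OpenFacts` it is an honest DEBT RECORD: none of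
  the four has a `_holds` in the tree (Hilbert schemes of points are not constructed), expected `stub-blocked`.
* `TwinTwistorTransport_of` takes `(h₁ : HilbertFacts)` and rebuilds `HilbertPackage` inside.
* Registered stubs after r7: `HilbertFacts`, `OpenFacts` (named facts), `LiftCarrier`, `LiftTransport` (the heart).
  Heart status (kernel-checked, `--supports` files): `LiftTransport` is crux-strength and no more
  (`Theorems…MukaiLift.liftTransport_of_twinTwistorTransport`, p115894); `LiftCarrier` is the mechanism's extra
  commitment (a rank ≥ 2 `μ_Ω`-stable vector bundle on the `10`-fold `S₀^{[3]} ⊗ S₀′^{[2]}` whose discriminant class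
  `κ₂ = ch₁² − 2r·ch₂` has mixed Künneth component `m·graph_q(M̃)`; ranks `0, 1` are excluded since then `κ₂ = 0`
  by `ch_of_hasRankLE_one`, so no degenerate witness of the tree's `IsMuStable` (vacuous for `r ≤ 1`) can serve).

## Reshape r8 (lead c4, after wave 1): `OpenFacts` shrunk to TWO named facts

Wave 1 (three workers, 18:05–18:30Z): `HilbertFacts` → `stub-blocked: Grothendieck_hilbertSchemeOfPoints_exists` (all four
undischarged; the tree constructs Hilbert schemes of `0` and `1` points only; no vacuity); `OpenFacts` → `stub-blocked:
K3_finrank_complexBetti_two`, with the NEW in-tree reduction of the orientation/signature package to `b₂ = 22` (p115801,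
17:13Z) — so `OpenFacts := K3_finrank_complexBetti_two ∧ Buskin2019_hodgeConjectureFor_square_of_CM` and
`TwinTwistorTransport_of` derives the package by `K3_exists_orientation_signature_hodgeRiemann_ample_of_finrank_complexBetti_two`;
`LiftTransport` → `stub-blocked:` the crux itself (tightness p115894; no junk route: every antecedent is an honest predicate
on the real carriers, the zero-κ package is excluded inside the package by `m ≠ 0` — worker lemma
`corrClass_ne_zero_of_liftAction` —, and `LiftAlg` is not cheaply true).  Registered stubs after r8: `HilbertFacts`,
`OpenFacts`, `LiftCarrier`, `LiftTransport`; named-fact debt of the line = 4 + 2 names; research debt = the heart.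
-/

set_option linter.dupNamespace false
set_option autoImplicit false

noncomputable section

namespace Summit.HodgeConjecture.HodgeConjecture.Cruxes.TwinTwistorTransport.MukaiLiftFullSimilitude

open CategoryTheory MonoidalCategory
open scoped Manifold BigOperators
open Literature.AlgebraicGeometry.Motives Literature.AlgebraicGeometry.HodgeTheory
open Literature.AlgebraicGeometry.Surfaces Literature.AlgebraicGeometry.Hyperkaehler
open Literature.AlgebraicGeometry.ModuliOfSheaves
open Literature.AlgebraicTopology.SingularHomology
open Literature.Geometry.Kaehler
open Summit.HodgeConjecture.HodgeConjecture.Theses.NikulinTwinTransport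

/-! ## Vocabulary

All vocabulary of the line (`PeriodPt`, `IsRatEnd`, `IsTwoSimilitudePair`, `corrH2`, `TwinAlg`,
`LiftLat`, `liftForm`, `liftEnd`, `ofZL`, `ofRL`, `reL`, `imL`, `liftPeriodDomain`,
`IsLiftPositiveThreeSpace`, `IsLiftGenericThreeSpace`, `liftTwistorLine`, `OnCommonGenericLiftLine`,
`MarkedHK`, `IsHilbLink`, `LiftAlg`, with the kernel-checked first lemmas `liftForm_liftEnd`,
`liftEnd_inl_smul`, `liftEnd_ofZL`, `mem_liftPeriodDomain_of_periodPt`, …) lives in the LANDED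
definitions file `Theorems/NikulinTwinTransportTwinTwistorTransportMukaiLiftDefs.lean` (p96190,
namespace `Summit.HodgeConjecture.HodgeConjecture.Theorems.TwinTwistorTransport.MukaiLift`, opened
below) so that stub files under `Theorems/` share it with this skeleton; marked K3 surfaces are the
Literature predicate `IsMarkedK3`. -/

open Summit.HodgeConjecture.HodgeConjecture.Theorems.TwinTwistorTransport.MukaiLift

/-! ## The stub statements (precise `Prop`s, taken BY NAME as the hypotheses of
`TwinTwistorTransport_of`; their sorried witnesses `Stub.<Name>` are the REGISTERED stubs — the
skeleton audit matches a hypothesis head to a declared stub by its last name component) -/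

/-- **Stub 1 · HilbertPackage** (XL formal, NO research risk — Hilbert schemes of points are not in
the tree).  For every `n ≥ 2` there is a reference variety `Xr` such that over every marked
projective K3 surface `(S, η, p, x)` there is a marked numerically-`K3^{[n]}` projective irreducible
symplectic `2n`-fold `(X, θ, pX)` with period `(x, 0)`, deformation equivalent to `Xr`, carrying for
every orientation family Hilbert-type links `(ι, ρ, c)` to `(S, η)`.  WHY TRUE: `X := S^{[n]}`
(Fogarty: smooth projective of dimension `2n`; Beauville 1983 Thm 3 / §6–§9: irreducible symplectic,
`H²(S^{[n]}, ℤ) = i(H²(S, ℤ)) ⊕ ℤδ` with `q|_{H²(S)} =` cup form, `q(δ) = −2(n−1)`, Fujiki constant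
`(2n)!/(n!2ⁿ) = (2n−1)!!`; `H^{2,0}(S^{[n]}) = i(H^{2,0}(S))`; `i = [Ξ_n]_*` for the universal family
`Ξ_n ⊂ S^{[n]} × S`; `ρ`, `ζ` as in `IsHilbLink`; all `S^{[n]}` of projective K3 surfaces are
deformation equivalent through families of K3 surfaces, Huybrechts 1999 §2; `Xr :=` any one of
them).  WHY IT MIGHT FAIL: only as RENDERED (normalisation of `complexGysin`/orientations in the link
identities — absorbed by `c` and by rescaling `ι`; the sign of `pX`).
[Beauville1983 §6–§9; Huybrechts1999 §1.11, §2; EllingsrudGoettscheLehn2001 (Chern numbers of `S^{[n]}`); Fujiki1987] -/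
def HilbertPackage : Prop :=
  ∀ n : ℕ, 2 ≤ n → ∃ Xr : SchemeOver ℂ,
    ∀ (S : SchemeOver ℂ) (hS : IsK3Surface S) (η : complexBetti S (2 * 1) ≃ₗ[ℂ] (K3Index → ℂ))
      (p : complexBetti S (2 * 2)) (x : K3Index → ℂ), IsMarkedK3 S η p x →
      ∃ (X : SchemeOver ℂ) (θ : complexBetti X (2 * 1) ≃ₗ[ℂ] LiftLat)
        (pX : complexBetti X (2 * (2 * n))) (hX : MarkedHK n X θ pX (x, 0)),
        AreDeformationEquivalent (2 * n) X Xr ∧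
          ∀ (μ : OrientationFamily), μ.HasPoincareDuality →
            ∃ (ι : complexBetti (X ⊗ S) (2 * 2)) (ρ : complexBetti (S ⊗ X) (2 * (2 * n))) (c : ℂ),
              IsHilbLink n μ S X (IsK3Surface.isSmoothProjective hS) hX.1.1 η θ pX ι ρ c

/-- **Stub 1′ · HilbertFacts** (reshape r7, lead c4: the named-fact residue of `HilbertPackage`).  The four
named LITERATURE facts about the Hilbert scheme of points of a projective K3 surface from which the landed glue
`Theorems…MukaiLift.HilbertPackage_of_facts` (p116353) derives `HilbertPackage` verbatim:
`Grothendieck_hilbertSchemeOfPoints_exists` (Göttsche Thm. 1.1.2: `(S^{[n]}, Ξ_n)` exists, projective),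
`Beauville1983_hilbertScheme_K3` (Beauville 1983 §6 (b), Thm. 3: `S^{[n]}` projective irreducible symplectic of
dimension `2n`), `Beauville1983_hilbertScheme_K3_markedLinks` (§6 Prop. 6, §9 Lemme 1: `H² = i(H²(S)) ⊕ ℤδ`,
Fujiki relation, incidence links `i = [Ξ_n]_*`, `ρ`, `ζ`), `Beauville1983_hilbertScheme_K3_deformationEquivalent`
(all `S^{[n]}`, `S` projective K3, deformation equivalent; Huybrechts 1999 §2).  None has a `_holds` in the tree
(no Hilbert scheme of points is constructed): expected `stub-blocked` on the four names, exactly like `OpenFacts`.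
[Beauville1983 §6 Thm. 3, Prop. 6, §9 Lemme 1; Gottsche1993 Thm. 1.1.2; Huybrechts1999 §2] -/
def HilbertFacts : Prop :=
  Grothendieck_hilbertSchemeOfPoints_exists.{0} ∧ Beauville1983_hilbertScheme_K3 ∧
    Beauville1983_hilbertScheme_K3_markedLinks ∧ Beauville1983_hilbertScheme_K3_deformationEquivalent

/-- `HilbertFacts` give `HilbertPackage` (the landed glue, p116353). -/
theorem hilbertPackage_of_hilbertFacts (h : HilbertFacts) : HilbertPackage :=
  HilbertPackage_of_facts h.1 h.2.1 h.2.2.1 h.2.2.2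

/-- **The open named facts of the line** (reshape r4; r2 replaced `K3MarkingExists`).  Exactly the
named LITERATURE inputs of the composition that still lack a discharge in the tree (wave-1 audit):
* `K3_finrank_complexBetti_two` (`b₂ = 22`, Huybrechts Ch. 1 §3.3) and
  `K3_exists_orientation_signature_hodgeRiemann_ample` (index `−16` of the complex orientation with the
  Hodge–Riemann / ample package, Huybrechts Ch. 1 Prop. 3.5, Ch. 6 Prop. 1.2) — the two inputs of the
  in-tree assembly `Huybrechts_K3_marking_exists_holds_of` still unproved (the other five,
  `K3_even_intersectionForm`, Voisin I Cor. 7.6, the Hodge types of `H²(K3)`, model independence of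
  `hodgePQ` and de Rham's theorem, are THEOREMS: `K3_even_intersectionForm_holds`,
  `Voisin2002_closedForm_top_zero_not_exact_holds`, `Huybrechts_K3_hodgeTypes_H2_holds`,
  `hodgePQ_independent_of_hodgeModel_holds`, `exists_deRhamIsoFamily_holds`); they give the existence
  of markings `Huybrechts_K3_marking_exists` consumed by the tree's reduction and by the CM anchor;
* `Buskin2019_hodgeConjectureFor_square_of_CM` (the Hodge conjecture in codimension `2` for the
  square of a CM K3 surface; the input of the CM anchor; discharge OPEN in the tree).
Cup products of algebraic classes on triple products of surfaces
(`cupProduct_mem_algebraicClasses_tripleProduct_surfaces`, the composition-of-correspondences input of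
the CM anchor) is NOT here any more: it follows from the summit support item `CupProductAlgebraic`
(stmt-HodgeConjecture-14350), already a hypothesis of `TwinTwistorTransport_of` by name, through the
tree's `cupProduct_mem_algebraicClasses_tripleProduct_surfaces_of_cupProduct`.  Period surjectivity and
Buskin's theorem are the route items `K3PeriodSurjective` (15154) and `HodgeIsometryAlgebraic` (13675),
hypotheses by name.  Expected `stub-blocked` on the three names (0 live fact claims, 2026-08-16).
**Reshape r8 (lead c4, wave-1 audit 18:20Z):** the middle conjunct
`K3_exists_orientation_signature_hodgeRiemann_ample` FOLLOWS from `b₂ = 22` in the tree since 17:13Z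
(`K3_exists_orientation_signature_hodgeRiemann_ample_of_finrank_complexBetti_two`, p115801, file
`Surfaces/K3LatticeInvariantsSignatureProofs`; conversely `τ = 6 − b₂`, so the two were equivalent), hence the
debt is exactly TWO named facts: `K3_finrank_complexBetti_two` (b₂ = 22; live reduction route: p119208
`…_of_hirzebruch_of_oddBetti`, itself modulo the Hirzebruch signature theorem and `Huybrechts_K3_oddBetti_vanish`)
and `Buskin2019_hodgeConjectureFor_square_of_CM` (no reduction anywhere; "Discharge status: OPEN"). -/
def OpenFacts : Prop :=
  K3_finrank_complexBetti_two ∧ Buskin2019_hodgeConjectureFor_square_of_CM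

/-- **Stub 2 · CmTwinAnchor** (reshape r2 of `NikulinAnchor`; M glue over LANDED theorems).  Granted
period surjectivity, Buskin's theorem and `OpenFacts`: for every rational `2`-similitude `M` of `Λ_ℂ`
with rational two-sided inverse `N` and every orientation family there is ONE marked projective pair
`(S₀, η₀, p₀, x₀)`, `(S₀′, η₀′, p₀′, x₀′)` with `M x₀′ ∈ ℂx₀` on which the twin similitude
`η₀⁻¹ ∘ M ∘ η₀′` is `[γ]_*` for an algebraic `γ`.  WHY TRUE (in the tree): at a CM-norm period `x₀` of
multiplier `2` (`CmNormAnchors.exists_cmNormPeriod 2`: an eigen-period with non-real eigenvalue of a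
rational `2`-similitude `J`), realise `x₀` and `x₀′ := N x₀` by marked projective K3 surfaces (period
surjectivity); `η₀⁻¹ M η₀′ = (η₀⁻¹ J η₀) ∘ (η₀⁻¹ (J⁻¹M) η₀′)`, the first factor algebraic by the CM anchor
theorem `CmNormAnchors.stub_cmSelfSimilitude_algebraic` (HC for CM squares), the second a rational Hodge
ISOMETRY with matched periods, algebraic by Buskin; compose (`CorrComp[]`) — all of it the sibling
line's landed `OrdinaryPrimeAnchors.stub_cmTwinAnchor` (p109741).  The Nikulin species of the card
(Varesco 2023 Thm 2.1) would serve equally but its carriers are not in the tree.  WHY IT MIGHT FAIL: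
only as rendered (definitional agreement of the two lines' vocabularies).
[Buskin2019 Thm 1.1, §6.2; Huybrechts2019 Cor. 0.4 (ii); Varesco2023 Thm 2.1] -/
def CmTwinAnchor : Prop :=
  Theses.NikulinTwinTransport.K3PeriodSurjective → Theses.NikulinTwinTransport.HodgeIsometryAlgebraic →
  (Huybrechts_K3_marking_exists ∧ cupProduct_mem_algebraicClasses_tripleProduct_surfaces ∧
    Buskin2019_hodgeConjectureFor_square_of_CM) →
  ∀ (M N : Module.End ℂ (K3Index → ℂ)), IsTwoSimilitudePair M N →
    ∀ (μ : OrientationFamily), μ.HasPoincareDuality →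
      ∃ (S₀ S₀' : SchemeOver ℂ) (hS₀ : IsK3Surface S₀) (hS₀' : IsK3Surface S₀')
        (η₀ : complexBetti S₀ (2 * 1) ≃ₗ[ℂ] (K3Index → ℂ)) (p₀ : complexBetti S₀ (2 * 2))
        (x₀ : K3Index → ℂ) (η₀' : complexBetti S₀' (2 * 1) ≃ₗ[ℂ] (K3Index → ℂ))
        (p₀' : complexBetti S₀' (2 * 2)) (x₀' : K3Index → ℂ),
        IsMarkedK3 S₀ η₀ p₀ x₀ ∧ PeriodPt x₀ ∧ IsMarkedK3 S₀' η₀' p₀' x₀' ∧ PeriodPt x₀' ∧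
          (∃ t : ℂ, M x₀' = t • x₀) ∧ TwinAlg M μ S₀ S₀' hS₀ hS₀' η₀ η₀'

/-- **Stub 3 · LiftIffTwin** (L formal — the card's `Transfer`: crux ⟺ C⁺, POINTWISE along Hilbert-type
links; LANDED p100236 as `Theorems.TwinTwistorTransport.MukaiLift.LiftIffTwin`).  For a marked K3 pair
`(S, η)`, `(S′, η′)` and Hilbert-type linked marked `6`- and `4`-folds `(X, θ)` over `(S, η)`, `(X′, θ′)`
over `(S′, η′)`: the twin similitude `η⁻¹Mη′` is algebraic on `S × S′` IFF its Mukai lift `θ⁻¹M̃θ′` is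
algebraic on `X × X′` (granted the summit's support item `CupProductAlgebraic`, stmt-HodgeConjecture-14350,
by name, and `pX′ ≠ 0`, discharged at the call sites by `MarkedHK_pX_ne_zero`).
[Fulton1998 Prop. 16.1.1, Ex. 16.1.2; Buskin2019 Lemma 6.3; Beauville1983 §6] -/
def LiftIffTwin : Prop :=
  Theses.EndoscopicMiddleDegree.CupProductAlgebraic →
  ∀ (M : Module.End ℂ (K3Index → ℂ)) (μ : OrientationFamily), μ.HasPoincareDuality →
    ∀ (S S' : SchemeOver ℂ) (hS : IsK3Surface S) (hS' : IsK3Surface S')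
      (η : complexBetti S (2 * 1) ≃ₗ[ℂ] (K3Index → ℂ))
      (η' : complexBetti S' (2 * 1) ≃ₗ[ℂ] (K3Index → ℂ))
      (X X' : SchemeOver ℂ) (hX : IsSmoothProjective (2 * 3) X) (hX' : IsSmoothProjective (2 * 2) X')
      (θ : complexBetti X (2 * 1) ≃ₗ[ℂ] LiftLat) (θ' : complexBetti X' (2 * 1) ≃ₗ[ℂ] LiftLat)
      (pX : complexBetti X (2 * (2 * 3))) (pX' : complexBetti X' (2 * (2 * 2)))
      (ι : complexBetti (X ⊗ S) (2 * 2)) (ρ : complexBetti (S ⊗ X) (2 * (2 * 3))) (c : ℂ)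
      (ι' : complexBetti (X' ⊗ S') (2 * 2)) (ρ' : complexBetti (S' ⊗ X') (2 * (2 * 2))) (c' : ℂ),
      IsHilbLink 3 μ S X (IsK3Surface.isSmoothProjective hS) hX η θ pX ι ρ c →
      IsHilbLink 2 μ S' X' (IsK3Surface.isSmoothProjective hS') hX' η' θ' pX' ι' ρ' c' →
      pX' ≠ 0 →
      (TwinAlg M μ S S' hS hS' η η' ↔ LiftAlg M μ X X' hX hX' θ θ')

/-- **Stub 4 · TwistorReach** (M, PROVABLE NOW; 3/4 LANDED by lead gen-1: p101289
`…TwistorReachAlgebra`, p102031 `…TwistorReachLattice`, p102934 `…TwistorReachChain` with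
`latticeTwistorConnected` = Huybrechts Ch. 7 Prop. 3.2 for every non-degenerate symmetric integral
Gram matrix with a positive triple; Part C = transport to `LiftLat`, index type `Option K3Index`, Gram
`k3Gram ⊕ (−2)`, remains).  Any two points of the period domain of `(L, q₂) = Λ_{K3} ⊕ ⟨−2⟩`
(signature `(3, 20)`) are joined by a finite chain of GENERIC twistor lines (`W` positive of dimension
`3`, `W^⊥ ∩ (Λ ⊕ ℤδ) = 0`). [Huybrechts2016K3 Ch. 7 §3.1 Prop. 3.2; Markman2024 Def. 5.13, Lemma 5.14] -/
def TwistorReach : Prop :=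
  ∀ x ∈ liftPeriodDomain 2, ∀ y ∈ liftPeriodDomain 2,
    Relation.ReflTransGen (OnCommonGenericLiftLine 2) x y

/-- **Stub 5a · LiftCarrier** (THE MECHANISM'S COMMITMENT — research; reshape r6 splits the black-box
heart `LiftEngine` into its falsifiable half (this stub) and the transport theorem `LiftTransport`).  At
every ANCHOR of the composition — a marked projective `M`-twin K3 pair `(S₀, S₀′)` on which the twin
similitude is algebraic (`TwinAlg`), with Hilbert-type LINKED marked `6`- and `4`-folds `(X₀, θ₀)`,
`(X₀′, θ₀′)` over it (periods `(x₀, 0)`, `(x₀′, 0)`) — the Mukai lift `θ₀⁻¹ ∘ M̃ ∘ θ₀′` (algebraic there by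
`LiftIffTwin`) is REALISED BY A STABLE VECTOR BUNDLE: for some Chern character `C` additive on coherent
sheaves, some rational Kähler class `Ω` on `W = X₀ ⊗ X₀′` (positively orienting a volume generator
`vol`), a vector bundle `G` of `C`-rank `r` on `W`, `μ_Ω`-STABLE (Mumford–Takemoto, the tree's
`IsMuStable` on the `10`-fold), an algebraic class `λ` of codimension `2` on `X₀′` and `m ∈ ℂˣ`, the
correspondence `κ(G) ∪ pr₂^*λ ∈ H⁸(W(ℂ))`, `κ(G) := ch₁(G)² − 2r·ch₂(G) = c₂(End G)`, acts on `H²` as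
`m·(θ₀⁻¹ ∘ M̃ ∘ θ₀′)`.  WHY THIS SHAPE: one level up the correspondence class of `LiftAlg` lives in degree
`8` (Künneth type `H²(X₀) ⊗ H⁶(X₀′)`), and the card's `κ₂`-class acts "through the BBF form" — the bridge
is `∫_{X′} y ∪ y′ ∪ c₂(X′) = 30·q(y, y′)` on `K3^{[2]}`-type, so `λ = c₂(X₀′)/30` is the intended witness
(any algebraic `λ` is allowed: the clause only pins the `H² → H²` action); `m : ℂ`, not `ℤ`, and `μ`, `C`
are quantified OUTSIDE the existential (Disproof of the sibling crux NikulinSerreCarrier, gen 3 §L: an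
`∀ μ … ∃ m : ℤ` clause is killed by orientation twists).  WHY IT MIGHT BE TRUE: the card's convolution
kernel `𝒦_P = ℰ_v^∨ ∘ P ∘ ℰ_w` of the universal ideal sheaves through a non-split `P ∈ D^b(S₀ × S₀′)` with
`v(P) = graph(2Ψ̃)`; its class-level census passes (TRIAGE-r1-1 K1).  WHY IT MIGHT FAIL: no modular /
derived-equivalence origin for a `2`-similitude (Markman's `𝒰^{[n]}` needs `n = n`); Bogomolov–Gieseker
for `μ_Ω`-stable `G` (`∫ κ(G) ∪ Ω⁸ ≥ 0`) against the prescribed mixed term; integrality / HRR census one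
level up.  NOT implied by the crux (a stable-bundle realisation is genuinely stronger than algebraicity):
this is the stub a disprover should attack. [Markman2024 §1.4, §5; Buskin2019 §5; Verbitsky1996Hyperholomorphic Thm 2.5;
HuybrechtsLehn1997 Def. 1.2.12] -/
def LiftCarrier : Prop :=
  ∀ (M N : Module.End ℂ (K3Index → ℂ)), IsTwoSimilitudePair M N →
    ∀ (μ : OrientationFamily), μ.HasPoincareDuality →
    ∀ (S₀ S₀' : SchemeOver ℂ) (hS₀ : IsK3Surface S₀) (hS₀' : IsK3Surface S₀')
      (η₀ : complexBetti S₀ (2 * 1) ≃ₗ[ℂ] (K3Index → ℂ)) (p₀ : complexBetti S₀ (2 * 2)) (x₀ : K3Index → ℂ)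
      (η₀' : complexBetti S₀' (2 * 1) ≃ₗ[ℂ] (K3Index → ℂ)) (p₀' : complexBetti S₀' (2 * 2))
      (x₀' : K3Index → ℂ),
      IsMarkedK3 S₀ η₀ p₀ x₀ → PeriodPt x₀ → IsMarkedK3 S₀' η₀' p₀' x₀' → PeriodPt x₀' →
      (∃ t : ℂ, M x₀' = t • x₀) → TwinAlg M μ S₀ S₀' hS₀ hS₀' η₀ η₀' →
    ∀ (X₀ X₀' : SchemeOver ℂ) (θ₀ : complexBetti X₀ (2 * 1) ≃ₗ[ℂ] LiftLat)
      (θ₀' : complexBetti X₀' (2 * 1) ≃ₗ[ℂ] LiftLat) (pX₀ : complexBetti X₀ (2 * (2 * 3)))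
      (pX₀' : complexBetti X₀' (2 * (2 * 2)))
      (h₀ : MarkedHK 3 X₀ θ₀ pX₀ (x₀, 0)) (h₀' : MarkedHK 2 X₀' θ₀' pX₀' (x₀', 0)),
      (∃ (ι : complexBetti (X₀ ⊗ S₀) (2 * 2)) (ρ : complexBetti (S₀ ⊗ X₀) (2 * (2 * 3))) (c : ℂ),
          IsHilbLink 3 μ S₀ X₀ (IsK3Surface.isSmoothProjective hS₀) h₀.1.1 η₀ θ₀ pX₀ ι ρ c) →
      (∃ (ι' : complexBetti (X₀' ⊗ S₀') (2 * 2)) (ρ' : complexBetti (S₀' ⊗ X₀') (2 * (2 * 2))) (c' : ℂ),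
          IsHilbLink 2 μ S₀' X₀' (IsK3Surface.isSmoothProjective hS₀') h₀'.1.1 η₀' θ₀' pX₀' ι' ρ' c') →
    ∃ (C : ChernCharacterBetti) (Ω : complexBetti (X₀ ⊗ X₀') 2) (vol : complexBetti (X₀ ⊗ X₀') (2 * 10))
      (r : ℕ) (G : (X₀ ⊗ X₀').left.Modules) (lam : complexBetti X₀' (2 * 2)) (m : ℂ),
      (∀ (n : ℕ) (W : SchemeOver ℂ), IsSmoothProjective n W → CoherentAdditive C W) ∧
      IsRationalClass Ω ∧ IsKaehlerClass 10 (X₀ ⊗ X₀') Ω ∧ PositivelyOriented (X₀ ⊗ X₀') 10 Ω vol ∧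
      Literature.AlgebraicGeometry.Motives.IsVectorBundle G ∧ HasChRank C (X₀ ⊗ X₀') G r ∧
      IsMuStable C (X₀ ⊗ X₀') (rfl : 9 + 1 = 10) Ω vol G r ∧
      lam ∈ algebraicClasses X₀' 2 ∧ m ≠ 0 ∧
      ∀ y : complexBetti X₀' (2 * 1),
        corrH2 μ X₀ X₀' (2 * 3) (2 * 2) h₀.1.1 h₀'.1.1
          (cupProduct (rfl : 2 * 2 + 2 * 2 = 2 * (2 * 2))
            (cupProduct (rfl : 2 * 1 + 2 * 1 = 2 * 2) (C.ch (X₀ ⊗ X₀') G 1) (C.ch (X₀ ⊗ X₀') G 1) -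
              (2 * (r : ℂ)) • C.ch (X₀ ⊗ X₀') G 2)
            (complexBetti.map (SemiCartesianMonoidalCategory.snd X₀ X₀') (2 * 2) lam)) y =
        m • θ₀.symm (liftEnd M (θ₀' y))

/-- **Stub 5b · LiftTransport** (THE TRANSPORT THEOREM one level up — research; Markman 2024 Thm 1.5 /
Verbitsky–Kaledin–Verbitsky for a `2`-similitude-matched pair of DIFFERENT dimensions).  Fix `(M, N)`, an
orientation family, reference classes `(Xr, Xr′)` and an anchor: a marked pair `(X₀, θ₀) ~ Xr`,
`(X₀′, θ₀′) ~ Xr′` with `M̃`-matched periods at which the lift is algebraic AND carries a stable-bundle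
realisation (the package of `LiftCarrier`).  THEN at every marked projective `M`-twin K3 pair `(S, S′)`
with Hilbert-type linked marked `6`- and `4`-folds `(X, θ) ~ Xr`, `(X′, θ′) ~ Xr′` whose `X′`-period `(x′, 0)`
is joined to the anchor's by a chain of GENERIC twistor lines of `(L, q₂)`, the lift is algebraic.  WHY IT
MIGHT BE TRUE: deform `(X₀ × X₀′, End G)` as a twisted slope-polystable hyperholomorphic Azumaya algebra
along the DIAGONAL twistor path shadowing the chain (`Theorems…MukaiLift.matched_chain`: `M̃` is real and
conformal on positive three-spaces, so matched generic lines exist on the `X`-side), nodes at Pic-trivial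
pairs where stability is class-independent (Markman 2024 Lemmas 5.11–5.15, Prop. 5.19; Verbitsky 1996
Thm 2.5; Kaledin–Verbitsky 1998 Thm 3.19), GAGA + Künneth at the projective far end, birational maps
between marked pairs over the same period.  TIGHT: at linked far pairs the conclusion follows from twin
transport for `M` (`Theorems…MukaiLift.liftTransport_of_twinTransport`), so this half is crux-strength,
no more.  WHY IT MIGHT FAIL: Chern classes of the Kaledin–Verbitsky extension over the non-Kähler
twistor family restricting correctly; the anchor's stability cone must meet the generic matched
directions (`Negative/GenericFirstLine`, `AnchorConeCondition` one level up).
[Markman2024 Thm 1.1, 1.5, §5.2; Verbitsky1996Hyperholomorphic Thm 2.5; KaledinVerbitsky1998 Thm 3.19; Huybrechts1999 Thm 8.1] -/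
def LiftTransport : Prop :=
  ∀ (M N : Module.End ℂ (K3Index → ℂ)), IsTwoSimilitudePair M N →
    ∀ (μ : OrientationFamily), μ.HasPoincareDuality →
    ∀ (Xr Xr' X₀ X₀' : SchemeOver ℂ) (θ₀ : complexBetti X₀ (2 * 1) ≃ₗ[ℂ] LiftLat)
      (θ₀' : complexBetti X₀' (2 * 1) ≃ₗ[ℂ] LiftLat) (pX₀ : complexBetti X₀ (2 * (2 * 3)))
      (pX₀' : complexBetti X₀' (2 * (2 * 2))) (z₀ z₀' : LiftLat)
      (h₀ : MarkedHK 3 X₀ θ₀ pX₀ z₀) (h₀' : MarkedHK 2 X₀' θ₀' pX₀' z₀'),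
      AreDeformationEquivalent (2 * 3) X₀ Xr → AreDeformationEquivalent (2 * 2) X₀' Xr' →
      z₀ ∈ liftPeriodDomain 3 → z₀' ∈ liftPeriodDomain 2 → (∃ t : ℂ, liftEnd M z₀' = t • z₀) →
      LiftAlg M μ X₀ X₀' h₀.1.1 h₀'.1.1 θ₀ θ₀' →
      (∃ (C : ChernCharacterBetti) (Ω : complexBetti (X₀ ⊗ X₀') 2) (vol : complexBetti (X₀ ⊗ X₀') (2 * 10))
      (r : ℕ) (G : (X₀ ⊗ X₀').left.Modules) (lam : complexBetti X₀' (2 * 2)) (m : ℂ),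
      (∀ (n : ℕ) (W : SchemeOver ℂ), IsSmoothProjective n W → CoherentAdditive C W) ∧
      IsRationalClass Ω ∧ IsKaehlerClass 10 (X₀ ⊗ X₀') Ω ∧ PositivelyOriented (X₀ ⊗ X₀') 10 Ω vol ∧
      Literature.AlgebraicGeometry.Motives.IsVectorBundle G ∧ HasChRank C (X₀ ⊗ X₀') G r ∧
      IsMuStable C (X₀ ⊗ X₀') (rfl : 9 + 1 = 10) Ω vol G r ∧
      lam ∈ algebraicClasses X₀' 2 ∧ m ≠ 0 ∧
      ∀ y : complexBetti X₀' (2 * 1),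
        corrH2 μ X₀ X₀' (2 * 3) (2 * 2) h₀.1.1 h₀'.1.1
          (cupProduct (rfl : 2 * 2 + 2 * 2 = 2 * (2 * 2))
            (cupProduct (rfl : 2 * 1 + 2 * 1 = 2 * 2) (C.ch (X₀ ⊗ X₀') G 1) (C.ch (X₀ ⊗ X₀') G 1) -
              (2 * (r : ℂ)) • C.ch (X₀ ⊗ X₀') G 2)
            (complexBetti.map (SemiCartesianMonoidalCategory.snd X₀ X₀') (2 * 2) lam)) y =
        m • θ₀.symm (liftEnd M (θ₀' y))) →
    ∀ (S S' : SchemeOver ℂ) (hS : IsK3Surface S) (hS' : IsK3Surface S')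
      (η : complexBetti S (2 * 1) ≃ₗ[ℂ] (K3Index → ℂ)) (p : complexBetti S (2 * 2)) (x : K3Index → ℂ)
      (η' : complexBetti S' (2 * 1) ≃ₗ[ℂ] (K3Index → ℂ)) (p' : complexBetti S' (2 * 2)) (x' : K3Index → ℂ),
      IsMarkedK3 S η p x → PeriodPt x → IsMarkedK3 S' η' p' x' → PeriodPt x' → (∃ t : ℂ, M x' = t • x) →
    ∀ (X X' : SchemeOver ℂ) (θ : complexBetti X (2 * 1) ≃ₗ[ℂ] LiftLat)
      (θ' : complexBetti X' (2 * 1) ≃ₗ[ℂ] LiftLat) (pX : complexBetti X (2 * (2 * 3)))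
      (pX' : complexBetti X' (2 * (2 * 2)))
      (h : MarkedHK 3 X θ pX (x, 0)) (h' : MarkedHK 2 X' θ' pX' (x', 0)),
      AreDeformationEquivalent (2 * 3) X Xr → AreDeformationEquivalent (2 * 2) X' Xr' →
      (∃ (ι : complexBetti (X ⊗ S) (2 * 2)) (ρ : complexBetti (S ⊗ X) (2 * (2 * 3))) (c : ℂ),
          IsHilbLink 3 μ S X (IsK3Surface.isSmoothProjective hS) h.1.1 η θ pX ι ρ c) →
      (∃ (ι' : complexBetti (X' ⊗ S') (2 * 2)) (ρ' : complexBetti (S' ⊗ X') (2 * (2 * 2))) (c' : ℂ),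
          IsHilbLink 2 μ S' X' (IsK3Surface.isSmoothProjective hS') h'.1.1 η' θ' pX' ι' ρ' c') →
      Relation.ReflTransGen (OnCommonGenericLiftLine 2) z₀' (x', 0) →
      LiftAlg M μ X X' h.1.1 h'.1.1 θ θ'

/-! ## Registered stubs `Stub.<Name>` (`sorry` lives only here; statements = the `def`s above
unfolded one level over the vocabulary, so that a `--supports stmt-HodgeConjecture-14393` proof can
restate them verbatim over the landed Defs file) -/

namespace Stub

/-- Stub 1′, registered form (statement verbatim = def `HilbertFacts`; reshape r7): the four named Hilbert-scheme
facts, expected `stub-blocked` (no Hilbert scheme of points is constructed in the tree). -/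
theorem HilbertFacts : Grothendieck_hilbertSchemeOfPoints_exists.{0} ∧ Beauville1983_hilbertScheme_K3 ∧ Beauville1983_hilbertScheme_K3_markedLinks ∧ Beauville1983_hilbertScheme_K3_deformationEquivalent := by
  sorry

-- Stub 1 (`HilbertPackage`) is NOT sorried any more (reshape r7): `TwinTwistorTransport_of` rebuilds it from the
-- registered named-fact stub `Stub.HilbertFacts` through the LANDED glue `HilbertPackage_of_facts` (p116353).

/-- Stub 2 (`CmTwinAnchor`, reshape r2 of `NikulinAnchor`) is NOT sorried: LANDED by the wave-1 worker (p112591) as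
`Theorems.TwinTwistorTransport.MukaiLift.CmTwinAnchor` (glue over the sibling line's `OrdinaryPrimeAnchors.stub_cmTwinAnchor`). -/
theorem CmTwinAnchor : Theses.NikulinTwinTransport.K3PeriodSurjective → Theses.NikulinTwinTransport.HodgeIsometryAlgebraic → (Huybrechts_K3_marking_exists ∧ cupProduct_mem_algebraicClasses_tripleProduct_surfaces ∧ Buskin2019_hodgeConjectureFor_square_of_CM) → ∀ (M N : Module.End ℂ (K3Index → ℂ)), IsTwoSimilitudePair M N → ∀ (μ : OrientationFamily), μ.HasPoincareDuality → ∃ (S₀ S₀' : SchemeOver ℂ) (hS₀ : IsK3Surface S₀) (hS₀' : IsK3Surface S₀') (η₀ : complexBetti S₀ (2 * 1) ≃ₗ[ℂ] (K3Index → ℂ)) (p₀ : complexBetti S₀ (2 * 2)) (x₀ : K3Index → ℂ) (η₀' : complexBetti S₀' (2 * 1) ≃ₗ[ℂ] (K3Index → ℂ)) (p₀' : complexBetti S₀' (2 * 2)) (x₀' : K3Index → ℂ), IsMarkedK3 S₀ η₀ p₀ x₀ ∧ PeriodPt x₀ ∧ IsMarkedK3 S₀' η₀' p₀' x₀' ∧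 PeriodPt x₀' ∧ (∃ t : ℂ, M x₀' = t • x₀) ∧ TwinAlg M μ S₀ S₀' hS₀ hS₀' η₀ η₀' :=
  Summit.HodgeConjecture.HodgeConjecture.Theorems.TwinTwistorTransport.MukaiLift.CmTwinAnchor

/-- Stub 3 (the card's Transfer stub `LiftIffTwin`) is NOT sorried: it was reshaped and LANDED
(p100236): the Theorems theorem `Theorems.TwinTwistorTransport.MukaiLift.LiftIffTwin`, no `sorry`. -/
theorem LiftIffTwin : Summit.HodgeConjecture.HodgeConjecture.Theses.EndoscopicMiddleDegree.CupProductAlgebraic → ∀ (M : Module.End ℂ (K3Index → ℂ)) (μ : OrientationFamily), μ.HasPoincareDuality → ∀ (S S' : SchemeOver ℂ) (hS : IsK3Surface S) (hS' : IsK3Surface S') (η : complexBetti S (2 * 1) ≃ₗ[ℂ] (K3Index → ℂ)) (η' : complexBetti S' (2 * 1) ≃ₗ[ℂ] (K3Index → ℂ)) (X X' : SchemeOver ℂ) (hX : IsSmoothProjective (2 * 3) X) (hX' : IsSmoothProjective (2 * 2) X') (θ : complexBetti X (2 * 1) ≃ₗ[ℂ] LiftLat) (θ' : complexBetti X' (2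 * 1) ≃ₗ[ℂ] LiftLat) (pX : complexBetti X (2 * (2 * 3))) (pX' : complexBetti X' (2 * (2 * 2))) (ι : complexBetti (X ⊗ S) (2 * 2)) (ρ : complexBetti (S ⊗ X) (2 * (2 * 3))) (c : ℂ) (ι' : complexBetti (X' ⊗ S') (2 * 2)) (ρ' : complexBetti (S' ⊗ X') (2 * (2 * 2))) (c' : ℂ), IsHilbLink 3 μ S X (IsK3Surface.isSmoothProjective hS) hX η θ pX ι ρ c → IsHilbLink 2 μ S' X' (IsK3Surface.isSmoothProjective hS') hX' η' θ' pX' ι' ρ' c' → pX' ≠ 0 → (TwinAlg M μ S S' hS hS' η η' ↔ LiftAlg M μ X X' hX hX' θ θ') :=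
  Summit.HodgeConjecture.HodgeConjecture.Theorems.TwinTwistorTransport.MukaiLift.LiftIffTwin

/-- Stub 4 (`TwistorReach`) is NOT sorried: LANDED (parts A/B/B2 by lead gen-1, p101289/p102031/p102934; part C by the
wave-1 worker of lead c3, p112644) as `Theorems.TwinTwistorTransport.MukaiLift.TwistorReach`. -/
theorem TwistorReach : ∀ x ∈ liftPeriodDomain 2, ∀ y ∈ liftPeriodDomain 2, Relation.ReflTransGen (OnCommonGenericLiftLine 2) x y :=
  Summit.HodgeConjecture.HodgeConjecture.Theorems.TwinTwistorTransport.MukaiLift.TwistorReach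

/-- Stub 5a, registered form (statement verbatim = def `LiftCarrier`, reshape r6). -/
theorem LiftCarrier : ∀ (M N : Module.End ℂ (K3Index → ℂ)), IsTwoSimilitudePair M N → ∀ (μ : OrientationFamily), μ.HasPoincareDuality → ∀ (S₀ S₀' : SchemeOver ℂ) (hS₀ : IsK3Surface S₀) (hS₀' : IsK3Surface S₀') (η₀ : complexBetti S₀ (2 * 1) ≃ₗ[ℂ] (K3Index → ℂ)) (p₀ : complexBetti S₀ (2 * 2)) (x₀ : K3Index → ℂ) (η₀' : complexBetti S₀' (2 * 1) ≃ₗ[ℂ] (K3Index → ℂ)) (p₀' : complexBetti S₀' (2 * 2)) (x₀' : K3Index → ℂ), IsMarkedK3 S₀ η₀ p₀ x₀ → PeriodPt x₀ → IsMarkedK3 S₀' η₀' p₀' x₀' → PeriodPt x₀' → (∃ t : ℂ, M x₀' = t • x₀) → TwinAlg M μ S₀ S₀' hS₀ hS₀' η₀ η₀' → ∀ (X₀ X₀' : SchemeOver ℂ) (θ₀ : complexBetti X₀ (2 * 1) ≃ₗ[ℂ] LiftLat) (θ₀' : complexBetti X₀' (2 * 1) ≃ₗ[ℂ] LiftLat)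 (pX₀ : complexBetti X₀ (2 * (2 * 3))) (pX₀' : complexBetti X₀' (2 * (2 * 2))) (h₀ : MarkedHK 3 X₀ θ₀ pX₀ (x₀, 0)) (h₀' : MarkedHK 2 X₀' θ₀' pX₀' (x₀', 0)), (∃ (ι : complexBetti (X₀ ⊗ S₀) (2 * 2)) (ρ : complexBetti (S₀ ⊗ X₀) (2 * (2 * 3))) (c : ℂ), IsHilbLink 3 μ S₀ X₀ (IsK3Surface.isSmoothProjective hS₀) h₀.1.1 η₀ θ₀ pX₀ ι ρ c) → (∃ (ι' : complexBetti (X₀' ⊗ S₀') (2 * 2)) (ρ' : complexBetti (S₀' ⊗ X₀') (2 * (2 * 2))) (c' : ℂ), IsHilbLink 2 μ S₀' X₀' (IsK3Surface.isSmoothProjective hS₀') h₀'.1.1 η₀' θ₀' pX₀' ι' ρ' c') → ∃ (C : ChernCharacterBetti) (Ω : complexBetti (X₀ ⊗ X₀') 2) (vol : complexBetti (X₀ ⊗ X₀') (2 * 10)) (r : ℕ) (G : (X₀ ⊗ X₀').left.Modules) (lam : complexBetti X₀' (2 * 2)) (m : ℂ), (∀ (n : ℕ) (W : SchemeOver ℂ),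 IsSmoothProjective n W → CoherentAdditive C W) ∧ IsRationalClass Ω ∧ IsKaehlerClass 10 (X₀ ⊗ X₀') Ω ∧ PositivelyOriented (X₀ ⊗ X₀') 10 Ω vol ∧ Literature.AlgebraicGeometry.Motives.IsVectorBundle G ∧ HasChRank C (X₀ ⊗ X₀') G r ∧ IsMuStable C (X₀ ⊗ X₀') (rfl : 9 + 1 = 10) Ω vol G r ∧ lam ∈ algebraicClasses X₀' 2 ∧ m ≠ 0 ∧ ∀ y : complexBetti X₀' (2 * 1), corrH2 μ X₀ X₀' (2 * 3) (2 * 2) h₀.1.1 h₀'.1.1 (cupProduct (rfl : 2 * 2 + 2 * 2 = 2 * (2 * 2)) (cupProduct (rfl : 2 * 1 + 2 * 1 = 2 * 2) (C.ch (X₀ ⊗ X₀') G 1) (C.ch (X₀ ⊗ X₀') G 1) - (2 * (r : ℂ)) • C.ch (X₀ ⊗ X₀') G 2) (complexBetti.map (SemiCartesianMonoidalCategory.snd X₀ X₀') (2 * 2) lam)) y = m • θ₀.symm (liftEnd M (θ₀' y)) := by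
  sorry

/-- Stub 5b, registered form (statement verbatim = def `LiftTransport`, reshape r6; TIGHT). -/
theorem LiftTransport : ∀ (M N : Module.End ℂ (K3Index → ℂ)), IsTwoSimilitudePair M N → ∀ (μ : OrientationFamily), μ.HasPoincareDuality → ∀ (Xr Xr' X₀ X₀' : SchemeOver ℂ) (θ₀ : complexBetti X₀ (2 * 1) ≃ₗ[ℂ] LiftLat) (θ₀' : complexBetti X₀' (2 * 1) ≃ₗ[ℂ] LiftLat) (pX₀ : complexBetti X₀ (2 * (2 * 3))) (pX₀' : complexBetti X₀' (2 * (2 * 2))) (z₀ z₀' : LiftLat) (h₀ : MarkedHK 3 X₀ θ₀ pX₀ z₀) (h₀' : MarkedHK 2 X₀' θ₀' pX₀' z₀'), AreDeformationEquivalent (2 * 3) X₀ Xr → AreDeformationEquivalent (2 * 2) X₀' Xr' → z₀ ∈ liftPeriodDomain 3 → z₀' ∈ liftPeriodDomain 2 → (∃ t : ℂ, liftEnd M z₀' = t • z₀) → LiftAlg M μ X₀ X₀' h₀.1.1 h₀'.1.1 θ₀ θ₀' → (∃ (C : ChernCharacterBetti) (Ω : complexBetti (X₀ ⊗ X₀')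 2) (vol : complexBetti (X₀ ⊗ X₀') (2 * 10)) (r : ℕ) (G : (X₀ ⊗ X₀').left.Modules) (lam : complexBetti X₀' (2 * 2)) (m : ℂ), (∀ (n : ℕ) (W : SchemeOver ℂ), IsSmoothProjective n W → CoherentAdditive C W) ∧ IsRationalClass Ω ∧ IsKaehlerClass 10 (X₀ ⊗ X₀') Ω ∧ PositivelyOriented (X₀ ⊗ X₀') 10 Ω vol ∧ Literature.AlgebraicGeometry.Motives.IsVectorBundle G ∧ HasChRank C (X₀ ⊗ X₀') G r ∧ IsMuStable C (X₀ ⊗ X₀') (rfl : 9 + 1 = 10) Ω vol G r ∧ lam ∈ algebraicClasses X₀' 2 ∧ m ≠ 0 ∧ ∀ y : complexBetti X₀' (2 * 1), corrH2 μ X₀ X₀' (2 * 3) (2 * 2) h₀.1.1 h₀'.1.1 (cupProduct (rfl : 2 * 2 + 2 * 2 = 2 * (2 * 2)) (cupProduct (rfl : 2 * 1 + 2 * 1 = 2 * 2) (C.ch (X₀ ⊗ X₀') G 1) (C.ch (X₀ ⊗ X₀') G 1) - (2 * (r : ℂ)) • C.ch (X₀ ⊗ X₀') G 2) (complexBetti.map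 (SemiCartesianMonoidalCategory.snd X₀ X₀') (2 * 2) lam)) y = m • θ₀.symm (liftEnd M (θ₀' y))) → ∀ (S S' : SchemeOver ℂ) (hS : IsK3Surface S) (hS' : IsK3Surface S') (η : complexBetti S (2 * 1) ≃ₗ[ℂ] (K3Index → ℂ)) (p : complexBetti S (2 * 2)) (x : K3Index → ℂ) (η' : complexBetti S' (2 * 1) ≃ₗ[ℂ] (K3Index → ℂ)) (p' : complexBetti S' (2 * 2)) (x' : K3Index → ℂ), IsMarkedK3 S η p x → PeriodPt x → IsMarkedK3 S' η' p' x' → PeriodPt x' → (∃ t : ℂ, M x' = t • x) → ∀ (X X' : SchemeOver ℂ) (θ : complexBetti X (2 * 1) ≃ₗ[ℂ] LiftLat) (θ' : complexBetti X' (2 * 1) ≃ₗ[ℂ] LiftLat) (pX : complexBetti X (2 * (2 * 3))) (pX' : complexBetti X' (2 * (2 * 2))) (h : MarkedHK 3 X θ pX (x, 0)) (h' : MarkedHK 2 X' θ' pX' (x', 0)), AreDeformationEquivalent (2 * 3) X Xr → AreDeformationEquivalent (2 * 2) X' Xr' → (∃ (ι : complexBetti (X ⊗ S) (2 * 2)) (ρ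 : complexBetti (S ⊗ X) (2 * (2 * 3))) (c : ℂ), IsHilbLink 3 μ S X (IsK3Surface.isSmoothProjective hS) h.1.1 η θ pX ι ρ c) → (∃ (ι' : complexBetti (X' ⊗ S') (2 * 2)) (ρ' : complexBetti (S' ⊗ X') (2 * (2 * 2))) (c' : ℂ), IsHilbLink 2 μ S' X' (IsK3Surface.isSmoothProjective hS') h'.1.1 η' θ' pX' ι' ρ' c') → Relation.ReflTransGen (OnCommonGenericLiftLine 2) z₀' (x', 0) → LiftAlg M μ X X' h.1.1 h'.1.1 θ θ' := by
  sorry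

/-- Stub 6, registered form (statement verbatim = def `OpenFacts`, reshape r4; three named Literature facts, expected stub-blocked). -/
theorem OpenFacts : K3_finrank_complexBetti_two ∧ Buskin2019_hodgeConjectureFor_square_of_CM := by
  sorry

end Stub

/-! ## The composition (kernel-checked, no `sorry` below this line): the six stubs and the route
items `K3PeriodSurjective`, `HodgeIsometryAlgebraic` (by name) and the summit support item
`CupProductAlgebraic` (by name) give the route declaration
`Theses.NikulinTwinTransport.TwinTwistorTransport` BY NAME -/

/-- **`TwinTwistorTransport_of`** — the glue of the line (reshape r2).  `(M, N)` is the landed lattice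
`2`-similitude pair (`exists_twoSimilitude_k3Lattice`); `HilbertPackage` gives the reference classes
`(Xr, Xr′)`; `twinTwistorTransport_of_twinTransport` (fed with the route crux `K3PeriodSurjective` by
name — definitionally the Literature fact with `IsK3Surface` unfolded —, the markings assembled from
`OpenFacts` by `Huybrechts_K3_marking_exists_holds_of` and the tree's theorem `Huybrechts_K3_hodgeTypes_H2_holds`) then asks for `TwinTransportFor[M]`: given `μ` and an
`M`-twin marked pair `(S, S′)`, `CmTwinAnchor` supplies the `μ`-algebraic anchor pair `(S₀, S₀′)`,
`HilbertPackage` its Hilbert cube / square `(X₀, X₀′)` and the pair `(X, X′)` over `(S, S′)` with periods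
matched by `M̃` (`liftEnd_inl_smul`), `LiftIffTwin` (⇒) the lift `μ`-algebraic at the anchor,
`TwistorReach` a generic chain from `(x₀′, 0)` to `(x′, 0)`, `LiftEngine` the lift `μ`-algebraic at
`(X, X′)`, and `LiftIffTwin` (⇐) the twin `μ`-algebraic at `(S, S′)`.  Reshape r7: `h₁ : HilbertFacts`
(the four named Hilbert-scheme facts) and `HilbertPackage` is rebuilt inside by the landed glue
`HilbertPackage_of_facts` (p116353). -/
theorem TwinTwistorTransport_of (hP : Theses.NikulinTwinTransport.K3PeriodSurjective)
    (hB : Theses.NikulinTwinTransport.HodgeIsometryAlgebraic)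
    (hC : Theses.EndoscopicMiddleDegree.CupProductAlgebraic)
    (h₁ : HilbertFacts) (h₂ : CmTwinAnchor) (h₃ : LiftIffTwin)
    (h₄ : TwistorReach) (h₅ : LiftCarrier) (h₆ : OpenFacts) (h₇ : LiftTransport) :
    Theses.NikulinTwinTransport.TwinTwistorTransport := by
  have hHPkg : HilbertPackage := hilbertPackage_of_hilbertFacts h₁
  have hHT : Huybrechts_K3_hodgeTypes_H2 := Huybrechts_K3_hodgeTypes_H2_holds
  -- the named facts: markings from the two open leaves and the five landed discharges
  have hMk : Huybrechts_K3_marking_exists :=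
    Huybrechts_K3_marking_exists_holds_of h₆.1 K3_even_intersectionForm_holds
      (K3_exists_orientation_signature_hodgeRiemann_ample_of_finrank_complexBetti_two h₆.1)
      (fun E _ _ _ M _ _ => Voisin2002_closedForm_top_zero_not_exact_holds E M) hHT
      hodgePQ_independent_of_hodgeModel_holds
      (fun E _ _ _ => Literature.NumberTheory.Transcendental.exists_deRhamIsoFamily_holds E)
  -- cup products of algebraic classes on triple products of surfaces, from `CupProductAlgebraic`
  have hCUP : cupProduct_mem_algebraicClasses_tripleProduct_surfaces :=
    cupProduct_mem_algebraicClasses_tripleProduct_surfaces_of_cupProduct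
      (fun _ _ hV _ _ _ _ hx hy => hC hV _ _ _ _ hx hy)
  have hF : Huybrechts_K3_marking_exists ∧ cupProduct_mem_algebraicClasses_tripleProduct_surfaces ∧
      Buskin2019_hodgeConjectureFor_square_of_CM := ⟨hMk, hCUP, h₆.2⟩
  obtain ⟨M, N, hMrat, hNrat, hMN1, hNM1, hM2⟩ :=
    Theorems.NikulinTwinTransport.exists_twoSimilitude_k3Lattice
  have hMN : IsTwoSimilitudePair M N := ⟨hMrat, hNrat, hMN1, hNM1, hM2⟩
  obtain ⟨Xr, hpk⟩ := hHPkg 3 (by norm_num)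
  obtain ⟨Xr', hpk'⟩ := hHPkg 2 le_rfl
  -- the tree's reduction: it remains to prove `TwinTransportFor[M]`
  refine Theorems.NikulinTwinTransport.twinTwistorTransport_of_twinTransport hP hMk hHT M N
    hNrat hMN1 hNM1 hM2 ?_
  intro μ hμ S S' hS hS' η p x η' p' x' hm hx hm' hx' hper
  -- the anchor for this orientation family, one level up: Hilbert cube / square of the CM twin pair
  obtain ⟨S₀, S₀', hS₀, hS₀', η₀, p₀, x₀, η₀', p₀', x₀', hm₀, hx₀, hm₀', hx₀', ⟨t₀, ht₀⟩, halg₀⟩ :=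
    h₂ hP hB hF M N hMN μ hμ
  obtain ⟨X₀, θ₀, pX₀, hX₀, hdef₀, hlink₀⟩ := hpk S₀ hS₀ η₀ p₀ x₀ hm₀
  obtain ⟨X₀', θ₀', pX₀', hX₀', hdef₀', hlink₀'⟩ := hpk' S₀' hS₀' η₀' p₀' x₀' hm₀'
  obtain ⟨ι₀, ρ₀, c₀, hl₀⟩ := hlink₀ μ hμ
  obtain ⟨ι₀', ρ₀', c₀', hl₀'⟩ := hlink₀' μ hμ
  have hanchor : LiftAlg M μ X₀ X₀' hX₀.1.1 hX₀'.1.1 θ₀ θ₀' :=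
    (h₃ hC M μ hμ S₀ S₀' hS₀ hS₀' η₀ η₀' X₀ X₀' hX₀.1.1 hX₀'.1.1 θ₀ θ₀' pX₀ pX₀'
      ι₀ ρ₀ c₀ ι₀' ρ₀' c₀' hl₀ hl₀' (MarkedHK_pX_ne_zero μ hX₀')).1 (halg₀)
  have hz₀ : ((x₀, 0) : LiftLat) ∈ liftPeriodDomain 3 := mem_liftPeriodDomain_of_periodPt 3 hx₀
  have hz₀' : ((x₀', 0) : LiftLat) ∈ liftPeriodDomain 2 := mem_liftPeriodDomain_of_periodPt 2 hx₀'
  -- the target pair one level up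
  obtain ⟨X, θ, pX, hX, hdef, hlink⟩ := hpk S hS η p x hm
  obtain ⟨X', θ', pX', hX', hdef', hlink'⟩ := hpk' S' hS' η' p' x' hm'
  obtain ⟨ι, ρ, c, hl⟩ := hlink μ hμ
  obtain ⟨ι', ρ', c', hl'⟩ := hlink' μ hμ
  obtain ⟨t, ht⟩ := hper
  have hz : ((x, 0) : LiftLat) ∈ liftPeriodDomain 3 := mem_liftPeriodDomain_of_periodPt 3 hx
  have hz' : ((x', 0) : LiftLat) ∈ liftPeriodDomain 2 := mem_liftPeriodDomain_of_periodPt 2 hx'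
  -- the carrier at the anchor (the mechanism's commitment), then the transport theorem
  have hcar := h₅ M N hMN μ hμ S₀ S₀' hS₀ hS₀' η₀ p₀ x₀ η₀' p₀' x₀' hm₀ hx₀ hm₀' hx₀' ⟨t₀, ht₀⟩ halg₀
    X₀ X₀' θ₀ θ₀' pX₀ pX₀' hX₀ hX₀' ⟨ι₀, ρ₀, c₀, hl₀⟩ ⟨ι₀', ρ₀', c₀', hl₀'⟩
  have hLA : LiftAlg M μ X X' hX.1.1 hX'.1.1 θ θ' :=
    h₇ M N hMN μ hμ Xr Xr' X₀ X₀' θ₀ θ₀' pX₀ pX₀' (x₀, 0) (x₀', 0) hX₀ hX₀' hdef₀ hdef₀' hz₀ hz₀'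
      ⟨t₀, liftEnd_inl_smul ht₀⟩ hanchor hcar
      S S' hS hS' η p x η' p' x' hm hx hm' hx' ⟨t, ht⟩ X X' θ θ' pX pX' hX hX' hdef hdef'
      ⟨ι, ρ, c, hl⟩ ⟨ι', ρ', c', hl'⟩ (h₄ (x₀', 0) hz₀' (x', 0) hz')
  exact (h₃ hC M μ hμ S S' hS hS' η η' X X' hX.1.1 hX'.1.1 θ θ' pX pX' ι ρ c ι' ρ' c' hl hl'
    (MarkedHK_pX_ne_zero μ hX')).2 hLA

/-- **The skeleton**: the crux modulo the registered stubs, the route items `K3PeriodSurjective`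
(stmt-HodgeConjecture-15154) and `HodgeIsometryAlgebraic` (stmt-HodgeConjecture-13675) and the summit's
support item `CupProductAlgebraic` (stmt-HodgeConjecture-14350), all assumed by name. -/
theorem TwinTwistorTransport_skeleton (hP : Theses.NikulinTwinTransport.K3PeriodSurjective)
    (hB : Theses.NikulinTwinTransport.HodgeIsometryAlgebraic)
    (hC : Theses.EndoscopicMiddleDegree.CupProductAlgebraic) :
    Theses.NikulinTwinTransport.TwinTwistorTransport :=
  TwinTwistorTransport_of hP hB hC Stub.HilbertFacts Stub.CmTwinAnchor Stub.LiftIffTwin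
    Stub.TwistorReach Stub.LiftCarrier Stub.OpenFacts Stub.LiftTransport

end Summit.HodgeConjecture.HodgeConjecture.Cruxes.TwinTwistorTransport.MukaiLiftFullSimilitude

end
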